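import Summits.QuantumFields.YangMills.Theorems.BalabanUVNodesN08AtStage5View
import Literature.MathematicalPhysics.QuantumFieldTheory.Balaban1983to89.Node00.Record13Carriers
import Literature.MathematicalPhysics.QuantumFieldTheory.Balaban1983to89.Node00.Record13LiveSelector
import Literature.MathematicalPhysics.QuantumFieldTheory.Balaban1983to89.Node00.N03Record

/-!
# BalabanUVNodes ∕ N08 AT THE STAGE-13 RECORD OF RECORD — the ₁₃ storey of N08's census line over def-T's `Record13` (v1.1 p488788: β through the
# canonical-version transport `TcanOfRecord` and the (2.9) χ species `chiFixed29 ν ε₂₉`, `rstep` in the integrable form, `bg` on the ranged token) and the ₁₃ CARRIER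
# STACK (`Node00.Stage13Params.pinB10 ∕ view₁₃B10YZW`, dag-n10-d's `Node00/Record13Carriers`): pointed closers, the ∃-currency of the rev-16 nodes stub, and N08's share ON THE
# STAGE-13 WITNESS LINE OF RECORD `θ₁₃ = Node00.theta13LiveOfRecord F N` (node00-def-K0a, `Node00/Record13LiveSelector`) — where it costs `PrintedUV3V N F.L`
# (Track A, DAG node N08 [Balaban1985UV3] CMP **102** (1985) 255, Thm 1 p. 257 (compact reading) + Thm 2 p. 272; R134 fan-out seat `pub-ymgap-dag-n08-c` g6,
# strategy s2 «knit at the record of record», trigger (t5) = `Record13`, 2026-08-27)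

HONEST FRAMING.  Count-neutral kernel bookkeeping BY NAME — this seat's `N08StubNodes12Currency` (p474298) ∕ `N08StubNodes12WitnessLines` (p479702) recipe RE-RUN `12 ↦ 13`,
now ONE `exact` per view over the record-stage-generic module `N08AtStage5View` (p489533): the [B10] group is history-free, so neither the new transport nor the new χ
species nor the ₁₃ histories touch N08's leaf.  What is NEW at ₁₃ and proved here: (§0b) the [B10]-pin ∕ four-pin-view faces this file reads over dag-n10-d's `Node00/Record13Carriers` (the ₁₃ carrier stack, one
pen per dag-lead WORDS-130): the pinned view's `b10` leaf = `PrintedUV3V N θ.L`, the rev-16 guard `ZtUnity ∧ SlotsNondegenerate₁₃` pin-blind (`Iff.rfl` ×4), and «a world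
with def-T's pointed clauses bound over the [B10]-pinned ∕ the four-pin Stage-13 view IS a ₁₃C record AT THE SAME DATUM» (+ its existence, any window); (§1) at a world
bound over `(θ.pinB10).toStage5₁₃`, over any four-pin word, or over n10-d's `θ.view₁₃B10YZW` (= that word, `rfl`), N08 ⟸ `PrintedUV3V N θ.L` (and ⟺ «in-edges → it»); (§2) the ∃-CURRENCY: at the datum of ANY admissible Stage-13 tuple with provisos a world that IS a ₁₃C record of
`datumOfRecord₁₃ θ h`, bound over the pinned view, carrying N08 at every run — from `PrintedUV3V N θ.L`; hence «rev-16 K0‴ antecedent `∃ θ, Provisos₁₃ ∧ (ZtUnity ∧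
SlotsNondegenerate₁₃) ∧ Admissible` ⟹ N08's conjunct of the ₁₃ nodes-∃» from the socket `∀ L, Odd L → 1 < L → PrintedUV3V N L`, the guard riding on the SAME θ
(`…_of_inhabited13`, `_two` at `N = 2`), and the PINNED-PRESENTATION form (presenting parameter `θ.pinB10`, same datum, guard read AT it — the shape a pointed
assembler such as dag-n24-c's `N24_nodes₁₃_pointed` consumes); (§3) ON THE WITNESS LINE OF RECORD `θ₁₃` (block size `θ₁₃.L = F.L`, the family's own odd `L > 11`;
`γ = 1∕2`; admissible, `ZtUnity`, `SlotsNondegenerate₁₃ ⟸ Provisos₁₃` — K0a's theorems BY NAME): N08's share costs K0‴'s open row(s) at `θ₁₃` and THE SINGLE PROP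
`PrintedUV3V N F.L`; at `N = 2` and from ROW P11 `bg` ALONE (K0a's `provisos₁₃_theta13LiveOfRecord_of_bg`): «[Balaban1985UV3] Thm 1-compact ∧ Thm 2 with their printed
∃-prefix for SU(2) at the family's block size `F.L`, at some version of print's transformations» + row P11 ⟹ N08's conjunct (`…_of_bg_two`).  (§0) the in-edge guards
`b4 b5 b6 b7` at every ₁₃C record (transfer through def-T's `atWorld_of_isRecordOfRecord₁₃C`).  NOT A DISCHARGE OF N08: `PrintedUV3V` is TYPED, NOT PROVED — an
inhabitant (the [B10] cluster expansion at print's run objects; dag-n08-d's (α)-row programme) remains THE object gap; K0‴ ∕ K1‴ neither proved nor assumed beyond the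
displayed hypotheses; nothing of Bałaban's asserted; one finite four-torus per run at fixed `ε`, [B10]'s d = 3 lattices inside the record; nothing continuum ∕ ℝ⁴ ∕ OS
∕ mass gap ∕ Clay.  0 `sorry`, 0 `def`, standard axioms.  Filed `--supports` the (B)-side crux at the Stage-13
record, K1‴ `StabilityBAtRecordR13e` (stmt-QuantumFields-19910, route rev 16; dag-lead KEY TABLE WORDS-133) `--as helper` — its antecedent is §2∕§3's `hI` text verbatim.
Sources: [Balaban1985UV3] Thm 1 p.257, Thm 2 p.272; [Balaban1989LargeFieldII] Thm 1 + (0.1) pp.355–356; [Balaban1988Convergent] (3.16)–(3.22) pp.268–269, (2.28) p.259;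
[Balaban1987RG1] (0.21) p.256, (2.9) p.266.
-/

noncomputable section

namespace Summit.QuantumFields.YangMills.BalabanUVNodes.N08AtRecord13

open Literature.MathematicalPhysics.QuantumFieldTheory.Balaban1983to89
open Literature.MathematicalPhysics.QuantumFieldTheory.Balaban1983to89.T4Continuum (T4Family FiniteEpsData)
open Literature.MathematicalPhysics.QuantumFieldTheory.Balaban1983to89.DagBinding
  (WorldP leavesP PrintedCarriersR PrintedCarriers9X PrintedCarriers11 PrintedCarriers15)
open Literature.MathematicalPhysics.QuantumFieldTheory.Balaban1983to89.Node00
open Summit.QuantumFields.YangMills.BalabanUVNodes.N08AtStage5View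
open scoped Matrix.Norms.L2Operator

variable {F : T4Family} {N : ℕ} [NeZero N]

/-! ## §0 THE IN-EDGE GUARDS AT EVERY RUN OF EVERY STAGE-13 RECORD -/

section Guards
variable {D : FiniteEpsData F (SU N)} {w : WorldP}

/-- **In-edge guards at every run of a ₁₃C record**: the leaves `b4`, `b5`, `b6`, `b7` HOLD — N01 ∕ N02 ∕ N03 ∕ N04 are NODE 00 theorems at the Stage-5 shadow
(`Node00.b4∕b5∕b7_main_of_isRecordOfRecord₅C`, `Node00.N03_at_record₅C`), transferred by def-T's `Node00.atWorld_of_isRecordOfRecord₁₃C` (this seat's ₁₂ guards, re-instantiated).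
[cite: Balaban1983RegularityDecay, Theorem p.573; Balaban1984PropagatorsI, Props. 1.1–1.2 pp.33–36; Balaban1984PropagatorsII, Lemma 2.1 – Cor. 2.8 pp.234–249; Balaban1985Averaging, Props. 1–10 pp.26–50 (kernel versions at the objects of record; bookkeeping, transferred)] -/
theorem guards_of_isRecordOfRecord₁₃C (h : IsRecordOfRecord₁₃C F N D w) (P : B12.RunParams) :
    (leavesP w P).b4 ∧ (leavesP w P).b5 ∧ (leavesP w P).b6 ∧ (leavesP w P).b7 :=
  atWorld_of_isRecordOfRecord₁₃C (X := fun ℓ => ℓ.b4 ∧ ℓ.b5 ∧ ℓ.b6 ∧ ℓ.b7)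
    (fun _ _ h5 Q =>
      have h4 := b4_main_of_isRecordOfRecord₅C h5 Q
      have hb5 := b5_main_of_isRecordOfRecord₅C h5 Q h4
      ⟨h4, hb5, N03_at_record₅C h5 Q h4 hb5, b7_main_of_isRecordOfRecord₅C h5 Q hb5⟩)
    h P

/-- Hence at a ₁₃C record N08 reads `b8 → b9 → b11 → b10` (the in-edges `b5 b6 b7` drop out). [cite: Balaban1985UV3, Thm 1 p.257, Thm 2 p.272 (bookkeeping)] -/
theorem b10_main_iff_residual_of_isRecordOfRecord₁₃C (h : IsRecordOfRecord₁₃C F N D w) (P : B12.RunParams) :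
    Dag.B10_main (leavesP w P) ↔ ((leavesP w P).b8 → (leavesP w P).b9 → (leavesP w P).b11 → (leavesP w P).b10) := by
  obtain ⟨-, h5, h6, h7⟩ := guards_of_isRecordOfRecord₁₃C h P
  exact ⟨fun H h8 h9 h11 => H h5 h6 h7 h8 h9 h11, fun H _ _ _ h8 h9 h11 => H h8 h9 h11⟩

end Guards

/-! ## §0b THE [B10]-PIN ∕ FOUR-PIN-VIEW FACES AT STAGE 13 THIS FILE READS, over dag-n10-d's `Node00/Record13Carriers` (`Stage13Params.pinB10 ∕ pinY ∕ pinZ ∕ pinW`,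
`view₁₃B10YZW(_eq)`, `toStage5₁₃_pinB10`, `Provisos₁₃.pin<G>`, `datumOfRecord₁₃_pin<G>`, `…_admissible_iff`, `isRecordOfRecord₁₃C_pinB10_of_eq`, `upOfRecord₅C(S)_view₁₃…_leaves`
BY NAME): the pinned view's `b10` leaf, the guard per pin (`Iff.rfl`), the ₁₃C record over the FOUR-PIN view, and the two world constructions — in THIS namespace -/

section PinFaces
variable (θ : Stage13Params F N)

/-- **`(upOfRecord₅C ((θ.pinB10).toStage5₁₃) P).b10 ↔ PrintedUV3V N θ.L`** — g29's Stage-5 face along `Record13Carriers`' `toStage5₁₃_pinB10` (`rfl`). [cite: Balaban1985UV3, Thm 1 p.257 (compact reading) + Thm 2 p.272] -/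
theorem upOfRecord₅C_toStage5₁₃_pinB10_b10_iff (P : B12.RunParams) :
    (upOfRecord₅C F N ((θ.pinB10 F N).toStage5₁₃ F N) P).b10 ↔ PrintedUV3V N θ.L := by
  rw [Stage13Params.toStage5₁₃_pinB10]
  exact upOfRecord₅C_pinB10_b10_iff F N (θ.toStage5₁₃ F N) P

/-- … read by n05-a's S-binding (which re-binds `b8` only; `Iff.rfl` through it). [cite: Balaban1985UV3, Thm 1 p.257 + Thm 2 p.272; Balaban1985RegularSpaces, Thm 8 p.101 (bookkeeping)] -/
theorem upOfRecord₅CS_toStage5₁₃_pinB10_b10_iff (P : B12.RunParams) :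
    (upOfRecord₅CS F N ((θ.pinB10 F N).toStage5₁₃ F N) P).b10 ↔ PrintedUV3V N θ.L :=
  upOfRecord₅C_toStage5₁₃_pinB10_b10_iff θ P

/-- n10-d's `Stage13Params.view₁₃B10YZW` IS p489533's four-pin word at `σ := θ.toStage5₁₃` (`rfl`). [cite: Balaban1989LargeFieldII, Thm 1 p.355 (bookkeeping)] -/
theorem view₁₃B10YZW_eq_pin4 (Mstar : ℕ) (ops : OpsY N θ.toStage3Params Mstar) (ζ : ResidZ F N) (lamW : ResidW F N) :
    θ.view₁₃B10YZW F N Mstar ops ζ lamW =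
      ((((θ.toStage5₁₃ F N).pinB10 F N).pinY F N (Y9OfRecord N θ.toStage3Params Mstar ops)).pinZ F N (Z11OfRecord F N ζ)).pinW F N (WOfRecord₁₃ F N θ lamW) :=
  rfl

/-- **The rev-16 guard bundle is [B10]-pin-blind** (`Iff.rfl`: `ZtUnity` reads `Zt`, `SlotsNondegenerate₁₃` reads the numerics, `E₁₃`, the selector and the ₁₃ histories —
none of which the pin touches). [cite: Balaban1988Convergent, (3.16)–(3.22) pp.268–269 (bookkeeping)] -/
theorem guard_pinB10_iff : ((θ.pinB10 F N).ZtUnity F N ∧ (θ.pinB10 F N).SlotsNondegenerate₁₃ F N) ↔ (θ.ZtUnity F N ∧ θ.SlotsNondegenerate₁₃ F N) := Iff.rfl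

/-- … Y-pin-blind (`Iff.rfl`). [cite: Balaban1988Convergent, (3.16)–(3.22) pp.268–269 (bookkeeping)] -/
theorem guard_pinY_iff (Y₀ : PrintedCarriers9X) :
    ((θ.pinY F N Y₀).ZtUnity F N ∧ (θ.pinY F N Y₀).SlotsNondegenerate₁₃ F N) ↔ (θ.ZtUnity F N ∧ θ.SlotsNondegenerate₁₃ F N) := Iff.rfl

/-- … Z-pin-blind (`Iff.rfl`). [cite: Balaban1988Convergent, (3.16)–(3.22) pp.268–269 (bookkeeping)] -/
theorem guard_pinZ_iff (Z₀ : PrintedCarriers11) :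
    ((θ.pinZ F N Z₀).ZtUnity F N ∧ (θ.pinZ F N Z₀).SlotsNondegenerate₁₃ F N) ↔ (θ.ZtUnity F N ∧ θ.SlotsNondegenerate₁₃ F N) := Iff.rfl

/-- … W-pin-blind (`Iff.rfl`). [cite: Balaban1988Convergent, (3.16)–(3.22) pp.268–269 (bookkeeping)] -/
theorem guard_pinW_iff (W₀ : B12.RunParams → PrintedCarriers15) :
    ((θ.pinW F N W₀).ZtUnity F N ∧ (θ.pinW F N W₀).SlotsNondegenerate₁₃ F N) ↔ (θ.ZtUnity F N ∧ θ.SlotsNondegenerate₁₃ F N) := Iff.rfl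

/-- **EVERY admissible Stage-13 parameter with provisos presents a ₁₃C record at its own datum whose world is bound over the [B10]-PINNED view**, any window
`0 < γw ≤ θ.γ`, block size `θ.L` (def-T's world construction at `θ.pinB10`, through `Record13Carriers`' `isRecordOfRecord₁₃C_pinB10_of_eq`). [cite: Balaban1989LargeFieldII, Thm 1 + (0.1) pp.355–356 (bookkeeping)] -/
theorem exists_world_isRecordOfRecord₁₃C_pinB10 (h : θ.Provisos₁₃ F N) (hθ : θ.Admissible F N) {γw : ℝ} (hγw : 0 < γw ∧ γw ≤ θ.γ) :
    ∃ w : WorldP, IsRecordOfRecord₁₃C F N (datumOfRecord₁₃ F N θ h) w ∧ w.γ = γw ∧ w.L = (θ.L : ℝ) ∧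
      ∀ P, w.up P = upOfRecord₅C F N ((θ.pinB10 F N).toStage5₁₃ F N) P := by
  obtain ⟨w₀⟩ := nonempty_worldP
  exact ⟨{ w₀ with
      C := (datumOfRecord₁₃ F N θ h).C, γ := γw, L := (θ.L : ℝ), one_lt_L := by exact_mod_cast θ.hL.2,
      up := fun P => upOfRecord₅C F N ((θ.pinB10 F N).toStage5₁₃ F N) P },
    isRecordOfRecord₁₃C_pinB10_of_eq F N θ h hθ _ rfl hγw rfl (fun _ => rfl), rfl, rfl, fun _ => rfl⟩

/-- **A world with def-T's pointed clauses bound over n10-d's FOUR-PIN Stage-13 view IS a ₁₃C record AT `datumOfRecord₁₃ θ h`** (presenting parameter the quadruply pinned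
`θ`; provisos transported pin by pin, datum by the four `rfl`s, view by `view₁₃B10YZW_eq` — g33's `isRecordOfRecord₁₂C_of_isRecordOfRecord₁₂CB10YZW` recipe at Stage 13).
[cite: Balaban1989LargeFieldII, Thm 1 + (0.1) pp.355–356 (bookkeeping)] -/
theorem isRecordOfRecord₁₃C_view₁₃B10YZW_of_eq (h : θ.Provisos₁₃ F N) (hθ : θ.Admissible F N) (Mstar : ℕ) (ops : OpsY N θ.toStage3Params Mstar)
    (ζ : ResidZ F N) (lamW : ResidW F N) (w : WorldP) (hC : w.C = (datumOfRecord₁₃ F N θ h).C) (hγ : 0 < w.γ ∧ w.γ ≤ θ.γ) (hL : w.L = (θ.L : ℝ))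
    (hup : ∀ P, w.up P = upOfRecord₅C F N (θ.view₁₃B10YZW F N Mstar ops ζ lamW) P) :
    IsRecordOfRecord₁₃C F N (datumOfRecord₁₃ F N θ h) w := by
  have h₁ : (θ.pinB10 F N).Provisos₁₃ F N := h.pinB10
  have h₂ : ((θ.pinB10 F N).pinY F N (Y9OfRecord N θ.toStage3Params Mstar ops)).Provisos₁₃ F N := h₁.pinY _
  have h₃ : (((θ.pinB10 F N).pinY F N (Y9OfRecord N θ.toStage3Params Mstar ops)).pinZ F N (Z11OfRecord F N ζ)).Provisos₁₃ F N := h₂.pinZ _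
  have h₄ : ((((θ.pinB10 F N).pinY F N (Y9OfRecord N θ.toStage3Params Mstar ops)).pinZ F N (Z11OfRecord F N ζ)).pinW F N (WOfRecord₁₃ F N θ lamW)).Provisos₁₃ F N :=
    h₃.pinW _
  have hθ' : ((((θ.pinB10 F N).pinY F N (Y9OfRecord N θ.toStage3Params Mstar ops)).pinZ F N (Z11OfRecord F N ζ)).pinW F N (WOfRecord₁₃ F N θ lamW)).Admissible F N :=
    (Stage13Params.pinW_admissible_iff F N _ _).2 ((Stage13Params.pinZ_admissible_iff F N _ _).2
      ((Stage13Params.pinY_admissible_iff F N _ _).2 ((Stage13Params.pinB10_admissible_iff F N _).2 hθ)))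
  refine ⟨_, h₄, hθ', ?_, hC, hγ, hL, fun P => ?_⟩
  · rw [datumOfRecord₁₃_pinW F N _ h₃, datumOfRecord₁₃_pinZ F N _ h₂, datumOfRecord₁₃_pinY F N _ h₁, datumOfRecord₁₃_pinB10 F N θ h]
  · rw [hup P, Stage13Params.view₁₃B10YZW_eq]

/-- … hence EVERY admissible Stage-13 parameter with provisos presents a ₁₃C record at its own datum whose world is bound over the FOUR-PIN view (package EXPOSED: any floor
`Mstar`, operator layer `ops`, [B11] layer `ζ`, [IV] layer `lamW`), any window, block size `θ.L`. [cite: Balaban1989LargeFieldII, Thm 1 + (0.1) pp.355–356 (bookkeeping)] -/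
theorem exists_world_isRecordOfRecord₁₃C_view₁₃B10YZW (h : θ.Provisos₁₃ F N) (hθ : θ.Admissible F N) (Mstar : ℕ) (ops : OpsY N θ.toStage3Params Mstar)
    (ζ : ResidZ F N) (lamW : ResidW F N) {γw : ℝ} (hγw : 0 < γw ∧ γw ≤ θ.γ) :
    ∃ w : WorldP, IsRecordOfRecord₁₃C F N (datumOfRecord₁₃ F N θ h) w ∧ w.γ = γw ∧ w.L = (θ.L : ℝ) ∧
      ∀ P, w.up P = upOfRecord₅C F N (θ.view₁₃B10YZW F N Mstar ops ζ lamW) P := by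
  obtain ⟨w₀⟩ := nonempty_worldP
  exact ⟨{ w₀ with
      C := (datumOfRecord₁₃ F N θ h).C, γ := γw, L := (θ.L : ℝ), one_lt_L := by exact_mod_cast θ.hL.2,
      up := fun P => upOfRecord₅C F N (θ.view₁₃B10YZW F N Mstar ops ζ lamW) P },
    isRecordOfRecord₁₃C_view₁₃B10YZW_of_eq θ h hθ Mstar ops ζ lamW _ rfl hγw rfl (fun _ => rfl), rfl, rfl, fun _ => rfl⟩

end PinFaces

/-! ## §1 POINTED CLOSERS AT A WORLD BOUND OVER THE [B10]-PINNED STAGE-13 VIEW — cost: the one slot instance `PrintedUV3V N θ.L` -/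

section Pointed
variable (θ : Stage13Params F N) {w : WorldP}

/-- **EXACT READING**: at a world whose upstream block is the C-binding over `(θ.pinB10).toStage5₁₃`, the run's `b10` leaf IS `PrintedUV3V N θ.L` (`Record13Carriers`'
`upOfRecord₅C_toStage5₁₃_pinB10_b10_iff` read through p489533's generic atom). [cite: Balaban1985UV3, Thm 1 p.257 (compact reading) + Thm 2 p.272] -/
theorem b10_leaf_iff_of_up_pinB10 (hup : ∀ P, w.up P = upOfRecord₅C F N ((θ.pinB10 F N).toStage5₁₃ F N) P) (P : B12.RunParams) :
    (leavesP w P).b10 ↔ PrintedUV3V N θ.L :=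
  b10_leaf_iff_of_up_eq (hup P) (upOfRecord₅C_toStage5₁₃_pinB10_b10_iff θ P)

/-- **EXACT COST** there: N08 ⟺ «in-edge leaves `b5 b6 b7 b8 b9 b11` ⟹ `PrintedUV3V N θ.L`». [cite: Balaban1985UV3, Thm 1 p.257, Thm 2 p.272 (bookkeeping)] -/
theorem b10_main_iff_of_up_pinB10 (hup : ∀ P, w.up P = upOfRecord₅C F N ((θ.pinB10 F N).toStage5₁₃ F N) P) (P : B12.RunParams) :
    Dag.B10_main (leavesP w P) ↔
      ((leavesP w P).b5 → (leavesP w P).b6 → (leavesP w P).b7 → (leavesP w P).b8 → (leavesP w P).b9 → (leavesP w P).b11 → PrintedUV3V N θ.L) :=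
  b10_main_iff_of_up_eq (hup P) (upOfRecord₅C_toStage5₁₃_pinB10_b10_iff θ P)

/-- **N08 AT SUCH A WORLD FROM `PrintedUV3V N θ.L`** (in-edges unused; no datum, window or residual-layer hypothesis) — the PINNED binder a pointed Stage-13 assembler
(dag-n24-c's `N24_nodes₁₃_pointed` shape, presented at `θ.pinB10`) takes for N08 in place of the raw leaf-system slot. [cite: Balaban1985UV3, Thm 1 p.257 (compact reading) + Thm 2 p.272; Balaban1989LargeFieldII, Thm 1 + (0.1) pp.355–356 (bookkeeping)] -/
theorem b10_main_of_up_pinB10 (hup : ∀ P, w.up P = upOfRecord₅C F N ((θ.pinB10 F N).toStage5₁₃ F N) P) (hUV : PrintedUV3V N θ.L) (P : B12.RunParams) :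
    Dag.B10_main (leavesP w P) :=
  b10_main_of_up_eq (hup P) (upOfRecord₅C_toStage5₁₃_pinB10_b10_iff θ P) hUV

/-- Conversely N08 is not idle there: with its in-edge leaves it GIVES `PrintedUV3V N θ.L`. [cite: Balaban1985UV3, Thm 1 p.257, Thm 2 p.272 (bookkeeping)] -/
theorem printedUV3V_of_b10_main_of_up_pinB10 (hup : ∀ P, w.up P = upOfRecord₅C F N ((θ.pinB10 F N).toStage5₁₃ F N) P) {P : B12.RunParams}
    (h : Dag.B10_main (leavesP w P)) (h5 : (leavesP w P).b5) (h6 : (leavesP w P).b6) (h7 : (leavesP w P).b7) (h8 : (leavesP w P).b8)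
    (h9 : (leavesP w P).b9) (h11 : (leavesP w P).b11) : PrintedUV3V N θ.L :=
  of_b10_main_of_up_eq (hup P) (upOfRecord₅C_toStage5₁₃_pinB10_b10_iff θ P) h h5 h6 h7 h8 h9 h11

/-- The same world spelled over `(θ.toStage5₁₃).pinB10` (def-T's view, g29's Stage-5 pin; `toStage5₁₃_pinB10 : rfl`). [cite: Balaban1985UV3, Thm 1 p.257 + Thm 2 p.272 (bookkeeping)] -/
theorem b10_main_of_up_toStage5₁₃_pinB10 (hup : ∀ P, w.up P = upOfRecord₅C F N ((θ.toStage5₁₃ F N).pinB10 F N) P) (hUV : PrintedUV3V N θ.L)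
    (P : B12.RunParams) : Dag.B10_main (leavesP w P) :=
  N08AtStage5View.b10_main_of_up_pinB10 (θ.toStage5₁₃ F N) (hup P) hUV

/-- S-binding twin (a world bound by n05-a's S-binding over the pinned Stage-13 view). [cite: Balaban1985UV3, Thm 1 p.257 + Thm 2 p.272; Balaban1985RegularSpaces, Thm 8 p.101 (bookkeeping)] -/
theorem b10_main_of_upS_pinB10 (hup : ∀ P, w.up P = upOfRecord₅CS F N ((θ.pinB10 F N).toStage5₁₃ F N) P) (hUV : PrintedUV3V N θ.L) (P : B12.RunParams) :
    Dag.B10_main (leavesP w P) :=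
  b10_main_of_up_eq (hup P) (upOfRecord₅CS_toStage5₁₃_pinB10_b10_iff θ P) hUV

/-- **N08 AT A WORLD BOUND OVER ANY FOUR-PIN WORD OVER THE STAGE-13 VIEW** — `(((θ.toStage5₁₃.pinB10).pinY Y₀).pinZ Z₀).pinW W₀` for EVERY `Y₀ Z₀ W₀` (what a cumulative
Stage-13 view `view₁₃B10YZW` unfolds to) — from `PrintedUV3V N θ.L` (p489533 §3 at `σ := θ.toStage5₁₃`). [cite: Balaban1985UV3, Thm 1 p.257 (compact reading) + Thm 2 p.272; Balaban1989LargeFieldII, Thm 1 + (0.1) pp.355–356 (bookkeeping)] -/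
theorem b10_main_of_up_pin4 (Y₀ : PrintedCarriers9X) (Z₀ : PrintedCarriers11) (W₀ : B12.RunParams → PrintedCarriers15)
    (hup : ∀ P, w.up P = upOfRecord₅C F N (((((θ.toStage5₁₃ F N).pinB10 F N).pinY F N Y₀).pinZ F N Z₀).pinW F N W₀) P) (hUV : PrintedUV3V N θ.L)
    (P : B12.RunParams) : Dag.B10_main (leavesP w P) :=
  N08AtStage5View.b10_main_of_up_pin4 (θ.toStage5₁₃ F N) Y₀ Z₀ W₀ hup hUV P

/-- … exact cost there. [cite: Balaban1985UV3, Thm 1 p.257, Thm 2 p.272 (bookkeeping)] -/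
theorem b10_main_iff_of_up_pin4 (Y₀ : PrintedCarriers9X) (Z₀ : PrintedCarriers11) (W₀ : B12.RunParams → PrintedCarriers15)
    (hup : ∀ P, w.up P = upOfRecord₅C F N (((((θ.toStage5₁₃ F N).pinB10 F N).pinY F N Y₀).pinZ F N Z₀).pinW F N W₀) P) (P : B12.RunParams) :
    Dag.B10_main (leavesP w P) ↔
      ((leavesP w P).b5 → (leavesP w P).b6 → (leavesP w P).b7 → (leavesP w P).b8 → (leavesP w P).b9 → (leavesP w P).b11 → PrintedUV3V N θ.L) :=
  N08AtStage5View.b10_main_iff_of_up_pin4 (θ.toStage5₁₃ F N) Y₀ Z₀ W₀ hup P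

/-- … and over the [B8]-inner five-pin word bound by the S-binding (the world shape of a `…CB10YZWB8` key at Stage 13). [cite: Balaban1985UV3, Thm 1 p.257 + Thm 2 p.272; Balaban1985RegularSpaces, Thm 8 p.101 (bookkeeping)] -/
theorem b10_main_of_upS_pinB8_pin4 (lam : ResidB8 θ.toStage3Params) (Y₀ : PrintedCarriers9X) (Z₀ : PrintedCarriers11)
    (W₀ : B12.RunParams → PrintedCarriers15)
    (hup : ∀ P, w.up P = upOfRecord₅CS F N ((((((θ.toStage5₁₃ F N).pinB8 F N lam).pinB10 F N).pinY F N Y₀).pinZ F N Z₀).pinW F N W₀) P)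
    (hUV : PrintedUV3V N θ.L) (P : B12.RunParams) : Dag.B10_main (leavesP w P) :=
  N08AtStage5View.b10_main_of_upS_pinB8_pin4 (θ.toStage5₁₃ F N) lam Y₀ Z₀ W₀ hup hUV P


/-- **N08 AT A WORLD BOUND OVER n10-d's FOUR-PIN STAGE-13 VIEW `θ.view₁₃B10YZW Mstar ops ζ lamW`**, from `PrintedUV3V N θ.L` — ONE `exact` over p489533 (the view IS the
four-pin word, `view₁₃B10YZW_eq_pin4`). [cite: Balaban1985UV3, Thm 1 p.257 (compact reading) + Thm 2 p.272; Balaban1989LargeFieldII, Thm 1 + (0.1) pp.355–356 (bookkeeping)] -/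
theorem b10_main_of_up_view₁₃B10YZW (Mstar : ℕ) (ops : OpsY N θ.toStage3Params Mstar) (ζ : ResidZ F N) (lamW : ResidW F N)
    (hup : ∀ P, w.up P = upOfRecord₅C F N (θ.view₁₃B10YZW F N Mstar ops ζ lamW) P) (hUV : PrintedUV3V N θ.L) (P : B12.RunParams) :
    Dag.B10_main (leavesP w P) :=
  N08AtStage5View.b10_main_of_up_pin4 (θ.toStage5₁₃ F N) _ _ _ hup hUV P

/-- … exact reading there (= the `b10` conjunct of n10-d's `upOfRecord₅C_view₁₃B10YZW_leaves`, read at the world). [cite: Balaban1985UV3, Thm 1 p.257 + Thm 2 p.272 (bookkeeping)] -/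
theorem b10_leaf_iff_of_up_view₁₃B10YZW (Mstar : ℕ) (ops : OpsY N θ.toStage3Params Mstar) (ζ : ResidZ F N) (lamW : ResidW F N)
    (hup : ∀ P, w.up P = upOfRecord₅C F N (θ.view₁₃B10YZW F N Mstar ops ζ lamW) P) (P : B12.RunParams) : (leavesP w P).b10 ↔ PrintedUV3V N θ.L :=
  b10_leaf_iff_of_up_eq (hup P) (upOfRecord₅C_view₁₃B10YZW_leaves F N θ Mstar ops ζ lamW P).2.2.1

/-- … and over the five-pin view with [B8] bound by the S-binding (`view₁₃B8B10YZW = (θ.pinB8 λ).view₁₃B10YZW`). [cite: Balaban1985UV3, Thm 1 p.257 + Thm 2 p.272; Balaban1985RegularSpaces, Thm 8 p.101 (bookkeeping)] -/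
theorem b10_main_of_upS_view₁₃B8B10YZW (lam : ResidB8 θ.toStage3Params) (Mstar : ℕ) (ops : OpsY N θ.toStage3Params Mstar) (ζ : ResidZ F N)
    (lamW : ResidW F N) (hup : ∀ P, w.up P = upOfRecord₅CS F N (θ.view₁₃B8B10YZW F N lam Mstar ops ζ lamW) P) (hUV : PrintedUV3V N θ.L)
    (P : B12.RunParams) : Dag.B10_main (leavesP w P) :=
  b10_main_of_up_eq (hup P) (upOfRecord₅CS_view₁₃B8B10YZW_leaves F N θ lam Mstar ops ζ lamW P).2.2.2.1 hUV

end Pointed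

/-! ## §2 THE ∃-CURRENCY OF K1‴'s NODES STUB — N08's conjunct, the rev-16 guard `ZtUnity ∧ SlotsNondegenerate₁₃` riding on `θ` -/

section Currency

/-- **AT THE DATUM OF ANY ADMISSIBLE STAGE-13 TUPLE WITH PROVISOS, a world (any window height `γw`, block size `θ.L`) that IS a ₁₃C record of `datumOfRecord₁₃ F N θ h`,
bound over the [B10]-PINNED Stage-13 view, carrying N08 at every run — from the one slot instance `PrintedUV3V N θ.L`** (`Record13Carriers`' `exists_world_isRecordOfRecord₁₃C_pinB10`
+ §1).  The other nodes' pointed closers apply AT THIS `w` (its presenting parameter is `θ.pinB10`: every residual layer but the B10 run family, every history, law and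
letter is `θ`'s — `Record13Carriers` §2). [cite: Balaban1985UV3, Thm 1 p.257, Thm 2 p.272; Balaban1989LargeFieldII, Thm 1 + (0.1) pp.355–356 (the record's world; bookkeeping)] -/
theorem exists_world₁₃C_b10_main_of_slot (θ : Stage13Params F N) (h : θ.Provisos₁₃ F N) (hθ : θ.Admissible F N) {γw : ℝ} (hγw : 0 < γw ∧ γw ≤ θ.γ)
    (hUV : PrintedUV3V N θ.L) :
    ∃ w : WorldP, IsRecordOfRecord₁₃C F N (datumOfRecord₁₃ F N θ h) w ∧ w.γ = γw ∧ w.L = (θ.L : ℝ) ∧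
      (∀ P, w.up P = upOfRecord₅C F N ((θ.pinB10 F N).toStage5₁₃ F N) P) ∧ ∀ P : B12.RunParams, Dag.B10_main (leavesP w P) := by
  obtain ⟨w, hR, hγ, hL, hup⟩ := exists_world_isRecordOfRecord₁₃C_pinB10 θ h hθ hγw
  exact ⟨w, hR, hγ, hL, hup, b10_main_of_up_pinB10 θ hup hUV⟩

/-- **The four-pin twin** (package EXPOSED, as at Stage 12): at the same datum a world bound over `θ.view₁₃B10YZW Mstar ops ζ lamW` that IS a ₁₃C record and carries N08
at every run, from `PrintedUV3V N θ.L` — the world at which the other nodes' pointed closers over the four-pin view apply. [cite: Balaban1985UV3, Thm 1 p.257, Thm 2 p.272; Balaban1989LargeFieldII, Thm 1 + (0.1) pp.355–356 (bookkeeping)] -/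
theorem exists_world₁₃C_view₁₃B10YZW_b10_main_of_slot (θ : Stage13Params F N) (h : θ.Provisos₁₃ F N) (hθ : θ.Admissible F N) (Mstar : ℕ)
    (ops : OpsY N θ.toStage3Params Mstar) (ζ : ResidZ F N) (lamW : ResidW F N) {γw : ℝ} (hγw : 0 < γw ∧ γw ≤ θ.γ) (hUV : PrintedUV3V N θ.L) :
    ∃ w : WorldP, IsRecordOfRecord₁₃C F N (datumOfRecord₁₃ F N θ h) w ∧ w.γ = γw ∧ w.L = (θ.L : ℝ) ∧
      (∀ P, w.up P = upOfRecord₅C F N (θ.view₁₃B10YZW F N Mstar ops ζ lamW) P) ∧ ∀ P : B12.RunParams, Dag.B10_main (leavesP w P) := by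
  obtain ⟨w, hR, hγ, hL, hup⟩ := exists_world_isRecordOfRecord₁₃C_view₁₃B10YZW θ h hθ Mstar ops ζ lamW hγw
  exact ⟨w, hR, hγ, hL, hup, b10_main_of_up_view₁₃B10YZW θ Mstar ops ζ lamW hup hUV⟩

/-- **THE PINNED PRESENTATION**: from `θ`, its provisos, admissibility and guard, and `PrintedUV3V N θ.L` — a presenting parameter `θ' := θ.pinB10` with provisos `h'`, THE SAME
datum (`datumOfRecord₁₃_pinB10`), the guard and admissibility read AT `θ'` (carrier-blind, `Record13Carriers` §2), and a world bound over `θ'.toStage5₁₃` (def-T's UNPINNED clause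
shape at `θ'` — the `hup` a pointed Stage-13 assembler takes) that IS a ₁₃C record and carries N08 at every run. [cite: Balaban1985UV3, Thm 1 p.257, Thm 2 p.272; Balaban1989LargeFieldII, Thm 1 + (0.1) pp.355–356; Balaban1988Convergent, (3.16)–(3.22) pp.268–269 (the guard; bookkeeping)] -/
theorem exists_pinned_presentation₁₃C_b10_main (θ : Stage13Params F N) (h : θ.Provisos₁₃ F N) (hθ : θ.Admissible F N)
    (hG : θ.ZtUnity F N ∧ θ.SlotsNondegenerate₁₃ F N) {γw : ℝ} (hγw : 0 < γw ∧ γw ≤ θ.γ) (hUV : PrintedUV3V N θ.L) :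
    ∃ (θ' : Stage13Params F N) (h' : θ'.Provisos₁₃ F N) (w : WorldP), (θ'.ZtUnity F N ∧ θ'.SlotsNondegenerate₁₃ F N) ∧ θ'.Admissible F N ∧
      datumOfRecord₁₃ F N θ' h' = datumOfRecord₁₃ F N θ h ∧ w.C = (datumOfRecord₁₃ F N θ' h').C ∧ (0 < w.γ ∧ w.γ ≤ θ'.γ) ∧ w.γ = γw ∧ w.L = (θ'.L : ℝ) ∧
      (∀ P, w.up P = upOfRecord₅C F N (θ'.toStage5₁₃ F N) P) ∧ IsRecordOfRecord₁₃C F N (datumOfRecord₁₃ F N θ h) w ∧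
      ∀ P : B12.RunParams, Dag.B10_main (leavesP w P) := by
  obtain ⟨w, hR, hγ, hL, hup, hN⟩ := exists_world₁₃C_b10_main_of_slot θ h hθ hγw hUV
  refine ⟨θ.pinB10 F N, h.pinB10, w, (guard_pinB10_iff θ).2 hG, (Stage13Params.pinB10_admissible_iff F N θ).2 hθ,
    datumOfRecord₁₃_pinB10 F N θ h, ?_, ?_, hγ, hL, fun P => (hup P).trans (by rw [Stage13Params.toStage5₁₃_pinB10]), hR, hN⟩
  · rw [datumOfRecord₁₃_pinB10 F N θ h]; exact construction_eq_of_isRecordOfRecord₁₃C hR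
  · rw [hγ]; exact hγw

/-- **THE FOUR-PIN PRESENTATION** (package EXPOSED): presenting parameter `θ' := (((θ.pinB10).pinY (Y9OfRecord …)).pinZ (Z11OfRecord ζ)).pinW (WOfRecord₁₃ θ lamW)` — THE SAME datum
(the four `datumOfRecord₁₃_pin<G>`), guard and admissibility read AT `θ'` (pin-blind, §0b), a world bound over `θ'.toStage5₁₃` (= `θ.view₁₃B10YZW …`, `view₁₃B10YZW_eq`) that IS a
₁₃C record of `datumOfRecord₁₃ θ h` and carries N08 at every run — from `PrintedUV3V N θ.L`.  The shape a pointed Stage-13 assembler consumes when it presents the record at the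
quadruply pinned parameter. [cite: Balaban1985UV3, Thm 1 p.257, Thm 2 p.272; Balaban1989LargeFieldII, Thm 1 + (0.1) pp.355–356; Balaban1988Convergent, (3.16)–(3.22) pp.268–269 (bookkeeping)] -/
theorem exists_pinned4_presentation₁₃C_b10_main (θ : Stage13Params F N) (h : θ.Provisos₁₃ F N) (hθ : θ.Admissible F N)
    (hG : θ.ZtUnity F N ∧ θ.SlotsNondegenerate₁₃ F N) (Mstar : ℕ) (ops : OpsY N θ.toStage3Params Mstar) (ζ : ResidZ F N) (lamW : ResidW F N) {γw : ℝ}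
    (hγw : 0 < γw ∧ γw ≤ θ.γ) (hUV : PrintedUV3V N θ.L) :
    ∃ (θ' : Stage13Params F N) (h' : θ'.Provisos₁₃ F N) (w : WorldP), (θ'.ZtUnity F N ∧ θ'.SlotsNondegenerate₁₃ F N) ∧ θ'.Admissible F N ∧
      datumOfRecord₁₃ F N θ' h' = datumOfRecord₁₃ F N θ h ∧ w.C = (datumOfRecord₁₃ F N θ' h').C ∧ (0 < w.γ ∧ w.γ ≤ θ'.γ) ∧ w.γ = γw ∧ w.L = (θ'.L : ℝ) ∧
      (∀ P, w.up P = upOfRecord₅C F N (θ'.toStage5₁₃ F N) P) ∧ (∀ P, w.up P = upOfRecord₅C F N (θ.view₁₃B10YZW F N Mstar ops ζ lamW) P) ∧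
      IsRecordOfRecord₁₃C F N (datumOfRecord₁₃ F N θ h) w ∧ ∀ P : B12.RunParams, Dag.B10_main (leavesP w P) := by
  obtain ⟨w, hR, hγ, hL, hup, hN⟩ := exists_world₁₃C_view₁₃B10YZW_b10_main_of_slot θ h hθ Mstar ops ζ lamW hγw hUV
  have h₁ : (θ.pinB10 F N).Provisos₁₃ F N := h.pinB10
  have h₂ : ((θ.pinB10 F N).pinY F N (Y9OfRecord N θ.toStage3Params Mstar ops)).Provisos₁₃ F N := h₁.pinY _
  have h₃ : (((θ.pinB10 F N).pinY F N (Y9OfRecord N θ.toStage3Params Mstar ops)).pinZ F N (Z11OfRecord F N ζ)).Provisos₁₃ F N := h₂.pinZ _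
  have h₄ : ((((θ.pinB10 F N).pinY F N (Y9OfRecord N θ.toStage3Params Mstar ops)).pinZ F N (Z11OfRecord F N ζ)).pinW F N (WOfRecord₁₃ F N θ lamW)).Provisos₁₃ F N :=
    h₃.pinW _
  have hD : datumOfRecord₁₃ F N _ h₄ = datumOfRecord₁₃ F N θ h := by
    rw [datumOfRecord₁₃_pinW F N _ h₃, datumOfRecord₁₃_pinZ F N _ h₂, datumOfRecord₁₃_pinY F N _ h₁, datumOfRecord₁₃_pinB10 F N θ h]
  refine ⟨_, h₄, w,
    (guard_pinW_iff _ _).2 ((guard_pinZ_iff _ _).2 ((guard_pinY_iff _ _).2 ((guard_pinB10_iff θ).2 hG))),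
    (Stage13Params.pinW_admissible_iff F N _ _).2 ((Stage13Params.pinZ_admissible_iff F N _ _).2
      ((Stage13Params.pinY_admissible_iff F N _ _).2 ((Stage13Params.pinB10_admissible_iff F N _).2 hθ))),
    hD, ?_, ?_, hγ, hL, fun P => (hup P).trans (by rw [Stage13Params.view₁₃B10YZW_eq]), hup, hR, hN⟩
  · rw [hD]; exact construction_eq_of_isRecordOfRecord₁₃C hR
  · rw [hγ]; exact hγw

/-- **«K0‴'s ANTECEDENT ⟹ N08's CONJUNCT OF THE STAGE-13 NODES-∃»**, generic `N`: from `∃ θ, Provisos₁₃ ∧ (ZtUnity ∧ SlotsNondegenerate₁₃) ∧ Admissible` at `F` (HYPOTHESIS `hI`,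
the rev-16 guard bundled as ONE conjunct and carried to the SAME `θ` untouched) and the slot of record at every odd `L > 1` (HYPOTHESIS `hUV`, the node's object gap),
SOME guarded admissible tuple `θ`, provisos `h` and world `w` with `IsRecordOfRecord₁₃C F N (datumOfRecord₁₃ F N θ h) w` and `Dag.B10_main` at every run (`γw := θ.γ`).
NOT the stub (twelve conjuncts missing), NOT a discharge. [cite: Balaban1985UV3, Thm 1 p.257, Thm 2 p.272; Balaban1989LargeFieldII, Thm 1 + (0.1) pp.355–356; Balaban1988Convergent, (3.16)–(3.22) pp.268–269 (bookkeeping)] -/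
theorem exists_guarded_record₁₃C_b10_main_of_inhabited13
    (hI : ∃ θ : Stage13Params F N, θ.Provisos₁₃ F N ∧ (θ.ZtUnity F N ∧ θ.SlotsNondegenerate₁₃ F N) ∧ θ.Admissible F N)
    (hUV : ∀ L : ℕ, Odd L → 1 < L → PrintedUV3V N L) :
    ∃ (θ : Stage13Params F N) (h : θ.Provisos₁₃ F N) (w : WorldP), (θ.ZtUnity F N ∧ θ.SlotsNondegenerate₁₃ F N) ∧ θ.Admissible F N ∧
      IsRecordOfRecord₁₃C F N (datumOfRecord₁₃ F N θ h) w ∧ ∀ P : B12.RunParams, Dag.B10_main (leavesP w P) := by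
  obtain ⟨θ, h, hG, hθ⟩ := hI
  obtain ⟨w, hR, -, -, -, hN⟩ := exists_world₁₃C_b10_main_of_slot θ h hθ ⟨hθ.toStage9.gamma_pos, le_rfl⟩ (hUV θ.L θ.hL.1 θ.hL.2)
  exact ⟨θ, h, w, hG, hθ, hR, hN⟩

/-- **THE SAME AT THE GROUP OF RECORD `N = 2`, hypothesis = the rev-16 K0‴ text VERBATIM** (plan's `Record13Inhabited` body at `F`, node00-def-RR-2's token map §3:
`∃ θ : Stage13Params F 2, θ.Provisos₁₃ F 2 ∧ (θ.ZtUnity F 2 ∧ θ.SlotsNondegenerate₁₃ F 2) ∧ θ.Admissible F 2`): N08's conjunct of the ₁₃ nodes-∃ from it and the slot at every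
odd `L > 1`.  NOT the stub, NOT a discharge. [cite: Balaban1985UV3, Thm 1 p.257, Thm 2 p.272; Balaban1989LargeFieldII, Thm 1 + (0.1) pp.355–356 (bookkeeping)] -/
theorem exists_guarded_record₁₃C_b10_main_of_inhabited13_two (F : T4Family)
    (hI : ∃ θ : Stage13Params F 2, θ.Provisos₁₃ F 2 ∧ (θ.ZtUnity F 2 ∧ θ.SlotsNondegenerate₁₃ F 2) ∧ θ.Admissible F 2)
    (hUV : ∀ L : ℕ, Odd L → 1 < L → PrintedUV3V 2 L) :
    ∃ (θ : Stage13Params F 2) (h : θ.Provisos₁₃ F 2) (w : WorldP), (θ.ZtUnity F 2 ∧ θ.SlotsNondegenerate₁₃ F 2) ∧ θ.Admissible F 2 ∧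
      IsRecordOfRecord₁₃C F 2 (datumOfRecord₁₃ F 2 θ h) w ∧ ∀ P : B12.RunParams, Dag.B10_main (leavesP w P) :=
  exists_guarded_record₁₃C_b10_main_of_inhabited13 hI hUV

end Currency

/-! ## §3 ON THE STAGE-13 WITNESS LINE OF RECORD `θ₁₃ = theta13LiveOfRecord F N` (block size `F.L`, window `γ = 1∕2`) — N08's share costs `PrintedUV3V N F.L` -/

section WitnessLine
variable (F N)

/-- **The Stage-13 witness of record has THE FAMILY'S block size `θ₁₃.L = F.L`** (K0a's `theta13LiveOfFamily` over `stage3OfFamily F`, `stage3OfFamily_L`; `rfl`) — Bałaban's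
odd `L > 11` of the family itself (`T4Family.hL11`), no longer the displayed `3` of the Stage-12 line. [cite: Balaban1987RG1, (0.1) p.250 and (0.21) p.256 (the numerics of record; bookkeeping)] -/
theorem theta13LiveOfRecord_L : (theta13LiveOfRecord F N).L = F.L := rfl

/-- … and window height `θ₁₃.γ = 1∕2` (K0a's `theta13LiveOfFamily_γ`, `rfl`). [cite: Balaban1987RG1, (0.21) p.256 (bookkeeping)] -/
theorem theta13LiveOfRecord_γ : (theta13LiveOfRecord F N).γ = 1 / 2 := rfl

/-- **N08's SHARE OF THE STAGE-13 NODES STUB ON THE WITNESS LINE OF RECORD COSTS THE SINGLE PROP `PrintedUV3V N F.L`** (plus K0‴'s own provisos `hP` at `θ₁₃`, HYPOTHESIS;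
admissibility is K0a's THEOREM `admissible_theta13LiveOfRecord`): a world of `datumOfRecord₁₃ F N θ₁₃ hP` (`w.γ = 1∕2`, `w.L = F.L`), bound over the [B10]-pinned view of `θ₁₃`,
that is a ₁₃C record and carries N08 at every run.  At `N = 2`: [Balaban1985UV3] Thm 1-compact ∧ Thm 2 with their printed ∃-prefix for SU(2) at the family's block size `F.L`,
at some version of print's transformations. [cite: Balaban1985UV3, Thm 1 p.257, Thm 2 p.272; Balaban1989LargeFieldII, Thm 1 + (0.1) pp.355–356; Balaban1987RG1, (0.21) p.256 (bookkeeping)] -/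
theorem exists_world₁₃C_b10_main_at_theta13LiveOfRecord (hP : (theta13LiveOfRecord F N).Provisos₁₃ F N) (hUV : PrintedUV3V N F.L) :
    ∃ w : WorldP, IsRecordOfRecord₁₃C F N (datumOfRecord₁₃ F N (theta13LiveOfRecord F N) hP) w ∧ w.γ = 1 / 2 ∧ w.L = (F.L : ℝ) ∧
      (∀ P, w.up P = upOfRecord₅C F N (((theta13LiveOfRecord F N).pinB10 F N).toStage5₁₃ F N) P) ∧
      ∀ P : B12.RunParams, Dag.B10_main (leavesP w P) :=
  exists_world₁₃C_b10_main_of_slot (theta13LiveOfRecord F N) hP (admissible_theta13LiveOfRecord F N) (γw := 1 / 2)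
    ⟨one_half_pos, (theta13LiveOfRecord_γ F N).symm.le⟩ hUV

/-- **EXACT COST ON THE LINE**: at any world bound over the [B10]-pinned view of `θ₁₃`, N08 at a run ⟺ «in-edge leaves ⟹ `PrintedUV3V N F.L`». [cite: Balaban1985UV3, Thm 1 p.257, Thm 2 p.272] -/
theorem b10_main_iff_at_theta13LiveOfRecord {w : WorldP}
    (hup : ∀ P, w.up P = upOfRecord₅C F N (((theta13LiveOfRecord F N).pinB10 F N).toStage5₁₃ F N) P) (P : B12.RunParams) :
    Dag.B10_main (leavesP w P) ↔
      ((leavesP w P).b5 → (leavesP w P).b6 → (leavesP w P).b7 → (leavesP w P).b8 → (leavesP w P).b9 → (leavesP w P).b11 → PrintedUV3V N F.L) :=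
  b10_main_iff_of_up_pinB10 (theta13LiveOfRecord F N) hup P

/-- **N08's CONJUNCT OF THE STAGE-13 NODES-∃, WITNESSED AT `θ₁₃` OF RECORD, `N = 2`** — from K0‴'s open rows at the witness (`hP : θ₁₃.Provisos₁₃ F 2`, HYPOTHESIS) and
`PrintedUV3V 2 F.L`: the guard (`ztUnity_theta13LiveOfRecord`, `slotsNondegenerate₁₃_theta13LiveOfRecord hP`) and admissibility are K0a's theorems BY NAME.  NOT the stub, NOT
a discharge. [cite: Balaban1985UV3, Thm 1 p.257, Thm 2 p.272; Balaban1988Convergent, Thm 1 p.262, (3.16)–(3.22) pp.268–269; Balaban1989LargeFieldI, (0.3)–(0.4) p.176 (bookkeeping)] -/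
theorem exists_guarded_record₁₃C_b10_main_of_theta13Live_provisos_two (F : T4Family) (hP : (theta13LiveOfRecord F 2).Provisos₁₃ F 2)
    (hUV : PrintedUV3V 2 F.L) :
    ∃ (θ : Stage13Params F 2) (h : θ.Provisos₁₃ F 2) (w : WorldP), (θ.ZtUnity F 2 ∧ θ.SlotsNondegenerate₁₃ F 2) ∧ θ.Admissible F 2 ∧
      IsRecordOfRecord₁₃C F 2 (datumOfRecord₁₃ F 2 θ h) w ∧ ∀ P : B12.RunParams, Dag.B10_main (leavesP w P) := by
  obtain ⟨w, hR, -, -, -, hN⟩ := exists_world₁₃C_b10_main_at_theta13LiveOfRecord F 2 hP hUV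
  exact ⟨_, hP, w, ⟨ztUnity_theta13LiveOfRecord F 2, slotsNondegenerate₁₃_theta13LiveOfRecord F 2 hP⟩, admissible_theta13LiveOfRecord F 2, hR, hN⟩

/-- **★ N08's CONJUNCT OF THE STAGE-13 NODES-∃ AT `N = 2` FROM EXACTLY TWO DISPLAYED INPUTS: ROW P11 `bg` AT THE WITNESS OF RECORD (verbatim the text of `Provisos₁₃.bg`
there, on the ranged token `BgProvisoΛ`; K0a's `provisos₁₃_theta13LiveOfRecord_of_bg` supplies every other proviso row by theorem) AND `PrintedUV3V 2 F.L`.**  A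
REDUCTION — NOT a discharge; nothing of Bałaban's asserted. [cite: Balaban1985UV3, Thm 1 p.257, Thm 2 p.272; Balaban1988Convergent, (2.7) p.255, (2.28) p.259, (3.16)–(3.22) pp.268–269; Balaban1989LargeFieldI, (0.3)–(0.4) p.176 (bookkeeping)] -/
theorem exists_guarded_record₁₃C_b10_main_of_bg_two (F : T4Family)
    (hbg : ∀ (p : B12.RunParams) (n : ℕ), n ≤ p.K →
      Step.InInterval (theta13LiveOfRecord F 2).γ n (gOfRecord₁₃ F 2 (theta13LiveOfRecord F 2) p) →
        BgProvisoΛ F 2 p.K (settingOfRecord₁₃ F 2 (theta13LiveOfRecord F 2) p) ((theta13LiveOfRecord F 2).Rz p.K) (theta13LiveOfRecord F 2).τ9.M n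
          (suppOfRecord₁₃ F 2 (theta13LiveOfRecord F 2) p n) (UbgOfRecord₁₃ F 2 (theta13LiveOfRecord F 2) p n))
    (hUV : PrintedUV3V 2 F.L) :
    ∃ (θ : Stage13Params F 2) (h : θ.Provisos₁₃ F 2) (w : WorldP), (θ.ZtUnity F 2 ∧ θ.SlotsNondegenerate₁₃ F 2) ∧ θ.Admissible F 2 ∧
      IsRecordOfRecord₁₃C F 2 (datumOfRecord₁₃ F 2 θ h) w ∧ ∀ P : B12.RunParams, Dag.B10_main (leavesP w P) :=
  exists_guarded_record₁₃C_b10_main_of_theta13Live_provisos_two F (provisos₁₃_theta13LiveOfRecord_of_bg F 2 hbg) hUV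

end WitnessLine

end Summit.QuantumFields.YangMills.BalabanUVNodes.N08AtRecord13

end
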